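import Literature.AnabelianGeometry.SemiGraphs.BoundedOrderCoveringProofs
import HarnessLib

/-!
# [SemiAnbd] Proposition 2.5 (ii) — proof companion of `Commensurability.lean`

Mochizuki, *Semi-graphs of anabelioids*, Publ. RIMS **42** (2006), Proposition 2.5 (ii), author's
manuscript p. 27 [cite: MochizukiSemiAnbd2006, Prop. 2.5(ii) p.27]: for a connected, quasi-coherent
graph of anabelioids `𝒢` of bounded order, "there exists a normal open subgroup `H ⊆ Π_𝒢`, such that
all of the natural morphisms `Π_b → Π_𝒢/H`, `Π_v → Π_𝒢/H` are injective."  Printed proof (p. 27):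
"the Galois closure of a covering such as that constructed in the preceding paragraph [the glued
covering with trivial(ised) constituents — `BoundedOrderCoveringProofs.lean`] determines a normal
open subgroup `H ⊆ Π_𝒢` having the properties asserted in assertion (ii)."

Here: `proposition_2_5_ii_holds` DISCHARGES abc-iut-L3-t1's named fact
`SemiGraphOfAnabelioids.proposition_2_5_ii` (`Commensurability.lean`) AS TYPED.  With `A ∈ B(𝒢)` the
glued covering of `exists_boundedOrderCovering`, the subgroup is the kernel `N` of the action of
`Π_𝒢 = Aut(ρ_{v₀} ⋙ F₀)` on the fibre `F₀(A_{v₀})` (the open normal subgroup "determined by the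
Galois closure" of `A`): it is normal as a kernel, open as a finite intersection of stabilisers of
Mathlib's profinite topology on `Aut`, and `Π_v → Π_𝒢/N` (resp. `Π_b → Π_𝒢/N`) is injective because an
element of the kernel acts trivially on `F(A_v)` (resp. on `F(b^* A_v) ≅ F(A_e)`), a FREE `Π_v`-set
(resp. a free `Π_e`-set, using that `𝒢` is of injective type) — for every basepoint and every
transport of basepoints, as the typed statement demands.  Proof-only file, no definitions; the
hypotheses "connected" and "graph" of the typed statement are not needed for (ii).
Seat abc-iut-L6-t18 (ROW G26). Nothing here concerns [IUTchIII] Cor. 3.12.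
-/

namespace Literature.AnabelianGeometry.SemiGraphs

open CategoryTheory CategoryTheory.Limits CategoryTheory.PreGaloisCategory
open Literature.AnabelianGeometry.Anabelioids

universe v₁ u₁ u

namespace SemiGraphOfAnabelioids

/-- The kernel of the action of `Aut Φ` on a (finite, discrete) fibre `Φ(A)` is an open normal
subgroup, and an automorphism lies in it iff it acts trivially on `Φ(A)`.
[cite: MochizukiSemiAnbd2006, Prop. 2.5(ii) p.27] -/
theorem isOpen_ker_toPermHom_fiber {C : Type*} [Category C] (Φ : C ⥤ FintypeCat.{v₁}) (A : C) :
    IsOpen ((MulAction.toPermHom (Aut Φ) (Φ.obj A)).ker : Set (Aut Φ)) ∧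
      ∀ σ : Aut Φ, σ ∈ (MulAction.toPermHom (Aut Φ) (Φ.obj A)).ker ↔
        ∀ x : Φ.obj A, σ.hom.app A x = x := by
  have hmem : ∀ σ : Aut Φ, σ ∈ (MulAction.toPermHom (Aut Φ) (Φ.obj A)).ker ↔
      ∀ x : Φ.obj A, σ.hom.app A x = x := by
    intro σ
    rw [MonoidHom.mem_ker, Equiv.ext_iff]
    exact Iff.rfl
  refine ⟨?_, hmem⟩
  have hset : ((MulAction.toPermHom (Aut Φ) (Φ.obj A)).ker : Set (Aut Φ)) =
      ⋂ x : Φ.obj A, (MulAction.stabilizer (Aut Φ) x : Set (Aut Φ)) := by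
    ext σ
    simp only [SetLike.mem_coe, Set.mem_iInter, MulAction.mem_stabilizer_iff, hmem]
    exact Iff.rfl
  rw [hset]
  exact isOpen_iInter_of_finite fun x => stabilizer_isOpen (Aut Φ) x

/-- **[SemiAnbd] Proposition 2.5 (ii), unconditional form** (p. 27): for ANY semi-graph of
anabelioids `𝒢` of bounded order (of injective type, vertex groups finite of bounded order — neither
connectedness, nor "graph", nor quasi-coherence is used) and any basepoint `F₀` through a vertex
`v₀`, there is a normal open subgroup `N ⊆ Π_𝒢 = Aut(ρ_{v₀} ⋙ F₀)` such that for every vertex `v`,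
every basepoint `F` of `𝒢_v` and every transport `α` of basepoints the composite
`Π_v → Π_𝒢 → Π_𝒢/N` is injective, and likewise `Π_b → Π_𝒢/N` for every branch `b` abutting to a
vertex — `N` = the kernel of the action of `Π_𝒢` on the fibre of the glued covering of p. 27.  This is
the form the proof of [SemiAnbd] Prop. 2.6 (p. 28) applies to the approximator `𝒢′` restricted to
`𝕂`. [cite: MochizukiSemiAnbd2006, Prop. 2.5(ii) p.27] -/
theorem exists_openNormal_injective_of_isOfBoundedOrder (𝒢 : SemiGraphOfAnabelioids.{v₁, u₁, u})
    (hbo : 𝒢.IsOfBoundedOrder) (v₀ : 𝒢.graph.Vertex) (F₀ : 𝒢.V v₀ ⥤ FintypeCat.{v₁})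
    [FiberFunctor F₀] :
    ∃ (N : Subgroup (𝒢.Pi v₀ F₀)) (_ : N.Normal), IsOpen (N : Set (𝒢.Pi v₀ F₀)) ∧
      (∀ (v : 𝒢.graph.Vertex) (F : 𝒢.V v ⥤ FintypeCat.{v₁}) [FiberFunctor F]
          (α : 𝒢.ρ v ⋙ F ≅ 𝒢.ρ v₀ ⋙ F₀),
          Function.Injective ((QuotientGroup.mk' N).comp
            ((Aut.autMulEquivOfIso α).toMonoidHom.comp (𝒢.piVToPi v F)))) ∧
      ∀ (b : 𝒢.graph.Branch) (v : 𝒢.graph.Vertex) (h : 𝒢.graph.abuts b = some v)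
        (F : 𝒢.E (𝒢.graph.edgeOf b) ⥤ FintypeCat.{v₁}) [FiberFunctor F]
        (α : 𝒢.ρ v ⋙ ((𝒢.pull b v h).pullback ⋙ F) ≅ 𝒢.ρ v₀ ⋙ F₀),
        Function.Injective ((QuotientGroup.mk' N).comp
          ((Aut.autMulEquivOfIso α).toMonoidHom.comp (𝒢.piBToPi b v h F))) := by
  classical
  obtain ⟨M, hM, hbd⟩ := hbo.exists_bound
  obtain ⟨A, hAV, -⟩ := exists_boundedOrderCovering 𝒢 hbo.isOfInjectiveType hM hbd
  obtain ⟨hopen, hmem⟩ := isOpen_ker_toPermHom_fiber (𝒢.ρ v₀ ⋙ F₀) A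
  refine ⟨(MulAction.toPermHom (Aut (𝒢.ρ v₀ ⋙ F₀)) ((𝒢.ρ v₀ ⋙ F₀).obj A)).ker, inferInstance,
    hopen, ?_, ?_⟩
  · -- vertices
    intro v F _ α
    rw [injective_iff_map_eq_one]
    intro σ hσ
    rw [MonoidHom.comp_apply, MonoidHom.comp_apply, QuotientGroup.mk'_apply,
      QuotientGroup.eq_one_iff, hmem] at hσ
    obtain ⟨hfree, hcard⟩ := hAV v F
    -- `σ` acts trivially on `F(A_v)`
    have hfix : ∀ y : F.obj (A.S v), σ • y = y := by
      intro y
      have h := hσ (α.hom.app A y)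
      change α.hom.app A ((pi1Map (𝒢.ρ v) F σ).hom.app A (α.inv.app A (α.hom.app A y))) =
        α.hom.app A y at h
      rw [← FintypeCat.comp_apply (α.hom.app A) (α.inv.app A), α.hom_inv_id_app,
        FintypeCat.id_apply, pi1Map_hom_app] at h
      have hinjα : Function.Injective (α.hom.app A) := fun a b hab => by
        simpa using congrArg (α.inv.app A) hab
      exact hinjα h
    haveI : Nonempty (F.obj (A.S v)) := by
      rw [← Finite.card_pos_iff, hcard]; exact hM
    obtain ⟨y⟩ := this
    exact hfree σ y (hfix y)
  · -- branches
    intro b v h F _ α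
    rw [injective_iff_map_eq_one]
    intro τ hτ
    rw [MonoidHom.comp_apply, MonoidHom.comp_apply, QuotientGroup.mk'_apply,
      QuotientGroup.eq_one_iff, hmem] at hτ
    haveI : FiberFunctor ((𝒢.pull b v h).pullback ⋙ F) :=
      fiberFunctor_comp_of_exact (𝒢.pull b v h).pullback F
    obtain ⟨hfree, hcard⟩ := hAV v ((𝒢.pull b v h).pullback ⋙ F)
    have hfix : ∀ y : ((𝒢.pull b v h).pullback ⋙ F).obj (A.S v),
        (pi1Map (𝒢.pull b v h).pullback F τ) • y = y := by
      intro y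
      have h' := hτ (α.hom.app A y)
      change α.hom.app A ((pi1Map (𝒢.ρ v) ((𝒢.pull b v h).pullback ⋙ F)
        (pi1Map (𝒢.pull b v h).pullback F τ)).hom.app A (α.inv.app A (α.hom.app A y))) =
        α.hom.app A y at h'
      rw [← FintypeCat.comp_apply (α.hom.app A) (α.inv.app A), α.hom_inv_id_app,
        FintypeCat.id_apply, pi1Map_hom_app] at h'
      have hinjα : Function.Injective (α.hom.app A) := fun a b hab => by
        simpa using congrArg (α.inv.app A) hab
      exact hinjα h'
    haveI : Nonempty (((𝒢.pull b v h).pullback ⋙ F).obj (A.S v)) := by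
      rw [← Finite.card_pos_iff, hcard]; exact hM
    obtain ⟨y⟩ := this
    have h1 : pi1Map (𝒢.pull b v h).pullback F τ = 1 := hfree _ y (hfix y)
    exact hbo.isOfInjectiveType.isPi1Mono b v h F (h1.trans (map_one _).symm)

/-- **[SemiAnbd] Proposition 2.5 (ii)** (p. 27), DISCHARGED as typed (`proposition_2_5_ii`): for a
connected, quasi-coherent graph of anabelioids of bounded order there is a normal open subgroup
`N ⊆ Π_𝒢` such that all `Π_v → Π_𝒢/N`, `Π_b → Π_𝒢/N` are injective — by
`exists_openNormal_injective_of_isOfBoundedOrder` (the hypotheses "connected", "graph",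
"quasi-coherent" of the typed statement are not needed). [cite: MochizukiSemiAnbd2006, Prop. 2.5(ii) p.27] -/
theorem proposition_2_5_ii_holds : proposition_2_5_ii.{v₁, u₁, u} :=
  fun 𝒢 _ _ _ hbo v₀ F₀ _ => exists_openNormal_injective_of_isOfBoundedOrder 𝒢 hbo v₀ F₀

end SemiGraphOfAnabelioids

end Literature.AnabelianGeometry.SemiGraphs
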